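import Mathlib
import Summits.NavierStokesRegularity.NavierStokesRegularity.Theorems.TaoLadderRungTwoFlatJunkAmplitude
import Summits.NavierStokesRegularity.NavierStokesRegularity.Theorems.TaoLadderRungTwoFlatDatumUniqueness
import HarnessLib

/-!
# The junk amplitude along a DATUM SOLUTION of the homogeneous mirror lattice (λ₀ = 1): energy conservation ⇒ the
  energy budget of `…JunkAmplitude` (helper for the λ₀ = 1 layer stmt-NavierStokesRegularity-23908 `MirrorSolitaryWave`;
  route TaoLadderRungTwoFlat; cell harvest/h2-tao-ladder, p1 g21; LADDER §49.4)

* `IsDatumSol.sum_sq_le` — along the datum solution from `X₀`, every partial sum of site energies is bounded by the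
  datum's: `Σ_{n∈S} Σᵢ X_{i,n}(t)² ≤ Σᵢ X₀ᵢ²` (from `IsDatumSol.hasSum_sq`, energy conservation, p1 g20);
* `IsDatumSol.abs_le_outside_window` — hence, if the solution is `δ`-close to a reference `φ` on a finite window `W` at
  time `t`, every site outside `W` obeys `|X_{i₀,n₀}(t)| ≤ √(Σᵢ X₀ᵢ² − (max 0 (√(Σ_W Σᵢ φ²) − δ√(2|W|)))²)`. With the
  (JB) clause of `MirrorPulse.CapturedInGauge` (`½Σ X₀² < κ²E_{K₀}(Φ(0)) + junkThreshold·(κ/τ)²`) and `φ = κΦ(0)`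
  re-indexed to the window this is the a-priori junk amplitude `A` of the race (`…CoMovingEnergyDecay`).

HONEST FRAMING: bookkeeping about a MODEL lattice (Tao 2016 §4 vocabulary on `S♭`); nothing certified; nothing about
the Navier–Stokes equations.
-/

noncomputable section

-- the sub-problem namespace repeats the summit name by design (D-0017)
set_option linter.dupNamespace false

namespace Summit.NavierStokesRegularity.NavierStokesRegularity.Theorems

namespace MirrorPulse

/-- **Partial energies along a datum solution are bounded by the datum's energy** (twice the energy:
`Σ_{n∈S} Σᵢ X_{i,n}(t)² ≤ Σᵢ X₀ᵢ²` for every finite `S`). [cite: Tao2016AveragedNS, §4 (4.3) and proof of Lemma 4.1 (v);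
route TaoLadderRungTwoFlat, λ₀ = 1 layer] -/
theorem IsDatumSol.sum_sq_le {ε : ℝ} {X₀ : Fin 2 → ℝ} {X : Fin 2 → ℤ → ℝ → ℝ} (hX : IsDatumSol ε X₀ X) (t : ℝ)
    (S : Finset ℤ) : ∑ n ∈ S, ∑ i : Fin 2, X i n t ^ 2 ≤ ∑ i : Fin 2, X₀ i ^ 2 :=
  sum_le_hasSum S (fun _ _ => Finset.sum_nonneg fun _ _ => sq_nonneg _) (hX.hasSum_sq t)

/-- **JUNK AMPLITUDE ALONG A DATUM SOLUTION**: `δ`-closeness to `φ` on the window `W` at time `t` bounds every site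
outside `W` by `√(Σᵢ X₀ᵢ² − (max 0 (√(Σ_W Σᵢ φ²) − δ√(2|W|)))²)`. [cite: Tao2016AveragedNS, §4 (4.3); route
TaoLadderRungTwoFlat, L8b (LADDER §49.4: (JB) ⇒ junk amplitude)] -/
theorem IsDatumSol.abs_le_outside_window {ε : ℝ} {X₀ : Fin 2 → ℝ} {X : Fin 2 → ℤ → ℝ → ℝ}
    (hX : IsDatumSol ε X₀ X) (t : ℝ) {φ : Fin 2 → ℤ → ℝ} {δ : ℝ} (W : Finset ℤ) (hδ : 0 ≤ δ)
    (hdev : ∀ i, ∀ n ∈ W, |X i n t - φ i n| ≤ δ) {n₀ : ℤ} (hn₀ : n₀ ∉ W) (i₀ : Fin 2) :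
    |X i₀ n₀ t| ≤ Real.sqrt (∑ i : Fin 2, X₀ i ^ 2 - (max 0 (Real.sqrt (∑ n ∈ W, ∑ i : Fin 2, φ i n ^ 2)
      - δ * Real.sqrt (2 * (W.card : ℝ)))) ^ 2) := by
  have hE : ∀ S : Finset ℤ, ∑ n ∈ S, ∑ i : Fin 2, (fun i n => X i n t) i n ^ 2 ≤ 2 * ((∑ i : Fin 2, X₀ i ^ 2) / 2) :=
    fun S => by
      have h := hX.sum_sq_le t S
      have e : 2 * ((∑ i : Fin 2, X₀ i ^ 2) / 2) = ∑ i : Fin 2, X₀ i ^ 2 := by ring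
      rw [e]
      exact h
  have h := abs_le_of_energy_budget (z := fun i n => X i n t) (φ := φ) W hE hδ hdev hn₀ i₀
  have e : 2 * ((∑ i : Fin 2, X₀ i ^ 2) / 2) = ∑ i : Fin 2, X₀ i ^ 2 := by ring
  rw [e] at h
  exact h

end MirrorPulse

end Summit.NavierStokesRegularity.NavierStokesRegularity.Theorems

end
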